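import Literature.Analysis.FluidPDE.WeakSolution
import Literature.Analysis.FluidPDE.LerayHopf
import Literature.Analysis.FluidPDE.WholeSpaceIBP
import Literature.Analysis.FluidPDE.SpaceTimeCalculus
import Literature.Analysis.FluidPDE.ClassicalSolutionCalculus
import Mathlib.Analysis.Calculus.ContDiff.Bounds
import HarnessLib

/-!
# Extended test fields for `L⁴(Q_T)` distributional Navier–Stokes solutions: curl-type fields
  without compact spatial support

Analysis/FluidPDE support file in the discharge programme of the named fact
`Literature.Analysis.FluidPDE.galdi_energy_equality` (Galdi 2019, Proc. AMS 147, Thm. 1.1: a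
distributional solution of the unforced Navier–Stokes system on `ℝ³ × (0,T)` with datum
`v₀ ∈ L²_σ` which lies in `L⁴(0,T; L⁴)` is in the Leray–Hopf class), layer
`Literature.Analysis.FluidPDE.galdi_lerayHopf_class` (`NSGaldiEnergyEquality.lean`). That layer is
proved in the tree by *duality*: the weak formulation of `v` is tested against backward caloric
Duhamel integrals of test data, which are smooth and decay but are **not compactly supported in
space**. The accepted weak formulation `Fluid.IsWeakNSSolutionOn` only admits smooth, compactly
supported, divergence-free space–time test fields, so a density step is needed (in Galdi's proof
this is Lemma A.1, proved with Bogovskiĭ's operator). This file proves the density step for the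
class of **curl-type fields** `ψ = (∂ₐΨ) c - (∂_cΨ) a` (`a, c ∈ E`, `Ψ` a scalar function): such a
field is divergence free for *every* `C²` scalar `Ψ` (symmetry of second derivatives), so the
cut-off may be placed **inside** the curl, `ψ_R = (∂ₐ(χ_RΨ)) c - (∂_c(χ_RΨ)) a`, which is an
honest divergence-free test field — no divergence correction is required.

## Main result

* `Literature.Analysis.FluidPDE.IsWeakNSSolutionOn.weakForm_curlPair_extended`: let `v` be a weak
  (pressure-free, divergence-free-tested) solution on `E × [0,T)` with datum `v₀ ∈ L²`
  (`IsWeakNSSolutionOn T ν 0 v₀ v`) and `v ∈ L⁴` of the slab `(0,T) × E`; let `Ψ : ℝ → E → ℝ` be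
  jointly smooth, `Ψ(t) = 0` for `t ∉ [t₀, b]` with `b < T`, with `DᵏΨ ∈ L^{4/3}` of the slab for
  `k ≤ 3`, `DᵏΨ ∈ L²` of the slab for `k ≤ 2`, `Dᵏ∂ₜΨ ∈ L^{4/3}` of the slab for `k ≤ 1`, and
  `Ψ(0), DΨ(0) ∈ L²(E)`. Then for `ψ(t,x) = (DΨ(t)(x) a) c - (DΨ(t)(x) c) a`
  `∫₀ᵀ ∫ (⟪v, ∂ₜψ⟫ + ⟪v, (v·∇)ψ⟫ + ν⟪v, Δψ⟫) dx dt + ∫ ⟪v₀, ψ(0)⟫ dx = 0`.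

Supporting lemmas (all proved): the pointwise calculus of curl-type fields (`divergence_curlPair_eq_zero`,
`fderiv_curlPair`, `laplacian_curlPair`, `timeDeriv_curlPair`, norm bounds by iterated
derivatives), iterated spatial derivatives of slices of jointly smooth functions
(`iteratedFDeriv_slice_eq`, `continuous_iteratedFDeriv_slice`), uniform bounds on the iterated
derivatives of the radial cut-offs `Fluid.cutoff R`, `R ≥ 1` (`exists_norm_iteratedFDeriv_cutoff_le`)
and the Leibniz bound for cut-off products (`norm_iteratedFDeriv_mul_le_of_le`), the passage from
the mixed class `MemLqLp 4 4` to `L⁴` of the slab (`eLpNorm_uncurry_lt_top_of_memLqLp_four`).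

## Proof

For `R = n + 1` the field `ψ_R` is a smooth compactly supported divergence-free test field on
`(-∞, T) × E`, so the weak formulation applies. Pointwise, `ψ_R` and all its derivatives at
`(t, x)` coincide with those of `ψ` as soon as `R > ‖x‖ + 1` (the cut-off is `1` near `x`). By
the Leibniz rule and `‖Dⁱχ_R‖ ≤ C` (`R ≥ 1`), `‖Dᵐ(χ_RΨ(t))(x)‖ ≤ K Σ_{k≤m} ‖DᵏΨ(t)(x)‖`, whence
`|⟪v, ∂ₜψ_R⟫| + |⟪v, (v·∇)ψ_R⟫| + |ν⟪v, Δψ_R⟫|` is bounded, uniformly in `R`, by the integrable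
majorant `A(|v| Σ_{k≤1}|Dᵏ∂ₜΨ| + |v|² Σ_{k≤2}|DᵏΨ| + |ν| dim E · |v| Σ_{k≤3}|DᵏΨ|)` (Hölder
`L⁴ × L^{4/3}` and `L² × L²` on the slab), and similarly for the datum term; dominated
convergence concludes. No new definitions (the map `ℓ ↦ ℓ a • c - ℓ c • a` is a local notation).

## Mathlib / tree search

Mathlib (this pin) has the Leibniz bound `norm_iteratedFDeriv_mul_le`, composition with linear maps
(`ContinuousLinearMap.iteratedFDeriv_comp_right`, `iteratedFDeriv_comp_add_left`), the Laplacian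
API (`InnerProductSpace.laplacian_eq_iteratedFDeriv_orthonormalBasis`, `laplacian_congr_nhds`,
`ContDiffAt.laplacian_CLM_comp_left`), Schwarz (`ContDiffAt.isSymmSndFDerivAt`) and dominated
convergence; no Navier–Stokes notions. From the tree: `Fluid.IsWeakNSSolutionOn`, `Fluid.cutoff`
(`WholeSpaceIBP`), the space–time slice calculus (`SpaceTimeCalculus`, `ClassicalSolutionCalculus`:
`IsSmoothSpaceTimeOn.hasDerivAt_fderiv_slice_clm`, `.laplacian`, `.isSmoothSpaceTimeOn_deriv`),
`Fluid.MemLqLp` (`LerayHopf`).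

## References

* G. P. Galdi, *On the energy equality for distributional solutions to Navier–Stokes equations*,
  Proc. Amer. Math. Soc. 147 (2019), 785–792 (arXiv:1710.05725), proof of Thm. 1.1, (2.12), and
  Lemma A.1 (density of `𝒟_T` in the adjoint class). Bib key `Galdi2018`.
* H. Sohr, *The Navier–Stokes equations. An elementary functional analytic approach*, Birkhäuser
  2001, Ch. V, §1.3 (extension of the class of test functions of a weak solution). Bib key
  `Sohr2001`.
-/

noncomputable section

open MeasureTheory TopologicalSpace Set Function Filter Topology InnerProductSpace Metric
open scoped RealInnerProductSpace ENNReal NNReal ContDiff Laplacian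

namespace Literature.Analysis.FluidPDE

variable {E : Type*} [NormedAddCommGroup E] [InnerProductSpace ℝ E] [FiniteDimensional ℝ E]

/-- Local notation: the linear map `ℓ ↦ ℓ a • c - ℓ c • a` on covectors; composed with the
differential of a scalar function `g` it gives the curl-type field `(∂ₐ g) c - (∂_c g) a`. -/
local notation3 "𝐋[" a ", " c "]" =>
  ((ContinuousLinearMap.apply ℝ ℝ a).smulRight c - (ContinuousLinearMap.apply ℝ ℝ c).smulRight a :
    (E →L[ℝ] ℝ) →L[ℝ] E)

/-! ### The curl-type field `x ↦ (∂ₐ g)(x) c - (∂_c g)(x) a` of a scalar function -/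

section CurlPair

variable (a c : E)

omit [FiniteDimensional ℝ E] in
/-- `𝐋[a, c] ℓ = ℓ a • c - ℓ c • a`. [folklore] -/
@[simp] theorem curlPairCLM_apply (ℓ : E →L[ℝ] ℝ) : 𝐋[a, c] ℓ = ℓ a • c - ℓ c • a := by
  simp

omit [FiniteDimensional ℝ E] in
/-- `‖ℓ a • c - ℓ c • a‖ ≤ 2 ‖a‖ ‖c‖ ‖ℓ‖`. [folklore] -/
theorem norm_curlPairCLM_apply_le (ℓ : E →L[ℝ] ℝ) : ‖𝐋[a, c] ℓ‖ ≤ 2 * ‖a‖ * ‖c‖ * ‖ℓ‖ := by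
  rw [curlPairCLM_apply]
  calc ‖ℓ a • c - ℓ c • a‖ ≤ ‖ℓ a • c‖ + ‖ℓ c • a‖ := norm_sub_le _ _
    _ = ‖ℓ a‖ * ‖c‖ + ‖ℓ c‖ * ‖a‖ := by rw [norm_smul, norm_smul]
    _ ≤ ‖ℓ‖ * ‖a‖ * ‖c‖ + ‖ℓ‖ * ‖c‖ * ‖a‖ := by
        gcongr
        · exact ℓ.le_opNorm a
        · exact ℓ.le_opNorm c
    _ = 2 * ‖a‖ * ‖c‖ * ‖ℓ‖ := by ring

omit [FiniteDimensional ℝ E] in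
/-- `‖𝐋[a, c]‖ ≤ 2 ‖a‖ ‖c‖`. [folklore] -/
theorem opNorm_curlPairCLM_le : ‖𝐋[a, c]‖ ≤ 2 * ‖a‖ * ‖c‖ :=
  ContinuousLinearMap.opNorm_le_bound _ (by positivity) (norm_curlPairCLM_apply_le a c)

variable {a c}
variable {g : E → ℝ}

omit [FiniteDimensional ℝ E] in
/-- The curl-type field of a smooth scalar function is smooth. [folklore] -/
theorem contDiff_curlPair {n : ℕ∞} (hg : ContDiff ℝ ∞ g) :
    ContDiff ℝ n fun x => 𝐋[a, c] (fderiv ℝ g x) :=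
  (𝐋[a, c]).contDiff.comp ((hg.fderiv_right (m := ∞) (by norm_cast)).of_le (by exact_mod_cast le_top))

omit [FiniteDimensional ℝ E] in
/-- The differential of the curl-type field: `D(𝐋 ∘ Dg)(x) = 𝐋 ∘ D²g(x)`. [folklore] -/
theorem fderiv_curlPair (hg : ContDiff ℝ ∞ g) (x : E) :
    fderiv ℝ (fun x => 𝐋[a, c] (fderiv ℝ g x)) x = (𝐋[a, c]).comp (fderiv ℝ (fderiv ℝ g) x) := by
  have hd : DifferentiableAt ℝ (fderiv ℝ g) x :=
    ((hg.fderiv_right (m := 1) (by norm_cast)).differentiable one_ne_zero) x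
  exact ((𝐋[a, c]).hasFDerivAt.comp x hd.hasFDerivAt).fderiv

omit [FiniteDimensional ℝ E] in
/-- `‖𝐋(Dg(x))‖ ≤ 2‖a‖‖c‖ ‖D¹g(x)‖`. [folklore] -/
theorem norm_curlPair_le (x : E) :
    ‖𝐋[a, c] (fderiv ℝ g x)‖ ≤ 2 * ‖a‖ * ‖c‖ * ‖iteratedFDeriv ℝ 1 g x‖ := by
  rw [norm_iteratedFDeriv_one]
  exact norm_curlPairCLM_apply_le a c _

omit [FiniteDimensional ℝ E] in
/-- `‖D(𝐋 ∘ Dg)(x)‖ ≤ 2‖a‖‖c‖ ‖D²g(x)‖`. [folklore] -/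
theorem norm_fderiv_curlPair_le (hg : ContDiff ℝ ∞ g) (x : E) :
    ‖fderiv ℝ (fun x => 𝐋[a, c] (fderiv ℝ g x)) x‖ ≤ 2 * ‖a‖ * ‖c‖ * ‖iteratedFDeriv ℝ 2 g x‖ := by
  rw [fderiv_curlPair hg x]
  calc ‖(𝐋[a, c]).comp (fderiv ℝ (fderiv ℝ g) x)‖ ≤ ‖𝐋[a, c]‖ * ‖fderiv ℝ (fderiv ℝ g) x‖ :=
        ContinuousLinearMap.opNorm_comp_le _ _
    _ ≤ (2 * ‖a‖ * ‖c‖) * ‖iteratedFDeriv ℝ 2 g x‖ := by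
        rw [← norm_iteratedFDeriv_one (fderiv ℝ g), norm_iteratedFDeriv_fderiv]
        exact mul_le_mul_of_nonneg_right (opNorm_curlPairCLM_le a c) (norm_nonneg _)
    _ = 2 * ‖a‖ * ‖c‖ * ‖iteratedFDeriv ℝ 2 g x‖ := by ring

/-- `‖Δ f(x)‖ ≤ dim E · ‖D²f(x)‖` (the Laplacian is the trace of the Hessian). [folklore] -/
theorem norm_laplacian_le_finrank_mul {F : Type*} [NormedAddCommGroup F] [NormedSpace ℝ F]
    (f : E → F) (x : E) :
    ‖Δ f x‖ ≤ (Module.finrank ℝ E : ℝ) * ‖iteratedFDeriv ℝ 2 f x‖ := by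
  set b := stdOrthonormalBasis ℝ E
  have h := congrFun (laplacian_eq_iteratedFDeriv_orthonormalBasis f b) x
  rw [h]
  calc ‖∑ i, iteratedFDeriv ℝ 2 f x ![b i, b i]‖ ≤ ∑ i, ‖iteratedFDeriv ℝ 2 f x ![b i, b i]‖ :=
        norm_sum_le _ _
    _ ≤ ∑ _i : Fin (Module.finrank ℝ E), ‖iteratedFDeriv ℝ 2 f x‖ := by
        refine Finset.sum_le_sum fun i _ => ?_
        calc ‖iteratedFDeriv ℝ 2 f x ![b i, b i]‖
            ≤ ‖iteratedFDeriv ℝ 2 f x‖ * ∏ j, ‖(![b i, b i] : Fin 2 → E) j‖ :=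
              ContinuousMultilinearMap.le_opNorm _ _
          _ = ‖iteratedFDeriv ℝ 2 f x‖ := by
              simp [Fin.prod_univ_two, b.orthonormal.1 i]
    _ = (Module.finrank ℝ E : ℝ) * ‖iteratedFDeriv ℝ 2 f x‖ := by
        simp [Finset.sum_const, Finset.card_univ, Fintype.card_fin]

/-- The Laplacian of the curl-type field: `Δ(𝐋 ∘ Dg)(x) = 𝐋 (Δ(Dg)(x))`. [folklore] -/
theorem laplacian_curlPair (hg : ContDiff ℝ ∞ g) (x : E) :
    Δ (fun x => 𝐋[a, c] (fderiv ℝ g x)) x = 𝐋[a, c] (Δ (fderiv ℝ g) x) := by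
  have h2 : ContDiffAt ℝ 2 (fderiv ℝ g) x :=
    ((hg.fderiv_right (m := 2) (by norm_cast)).of_le le_rfl).contDiffAt
  have := h2.laplacian_CLM_comp_left (l := 𝐋[a, c])
  simpa [Function.comp_def] using this

/-- `‖Δ(𝐋 ∘ Dg)(x)‖ ≤ 2‖a‖‖c‖ · dim E · ‖D³g(x)‖`. [folklore] -/
theorem norm_laplacian_curlPair_le (hg : ContDiff ℝ ∞ g) (x : E) :
    ‖Δ (fun x => 𝐋[a, c] (fderiv ℝ g x)) x‖ ≤
      2 * ‖a‖ * ‖c‖ * (Module.finrank ℝ E) * ‖iteratedFDeriv ℝ 3 g x‖ := by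
  rw [laplacian_curlPair hg x]
  calc ‖𝐋[a, c] (Δ (fderiv ℝ g) x)‖ ≤ 2 * ‖a‖ * ‖c‖ * ‖Δ (fderiv ℝ g) x‖ :=
        norm_curlPairCLM_apply_le a c _
    _ ≤ 2 * ‖a‖ * ‖c‖ * ((Module.finrank ℝ E : ℝ) * ‖iteratedFDeriv ℝ 2 (fderiv ℝ g) x‖) := by
        gcongr
        exact norm_laplacian_le_finrank_mul _ _
    _ = 2 * ‖a‖ * ‖c‖ * (Module.finrank ℝ E) * ‖iteratedFDeriv ℝ 3 g x‖ := by
        rw [norm_iteratedFDeriv_fderiv]; ring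

/-- **The curl-type field is divergence free**: `div (x ↦ (∂ₐg) c - (∂_c g) a) = D²g(c, a) -
D²g(a, c) = 0` by the symmetry of second derivatives. [folklore] -/
theorem divergence_curlPair_eq_zero (hg : ContDiff ℝ ∞ g) (x : E) :
    VectorCalculus.divergence (fun x => 𝐋[a, c] (fderiv ℝ g x)) x = 0 := by
  set b := stdOrthonormalBasis ℝ E
  rw [divergence_eq_sum_inner_fderiv b, fderiv_curlPair hg x]
  have hsymm : IsSymmSndFDerivAt ℝ g x :=
    hg.contDiffAt.isSymmSndFDerivAt
      (by rw [minSmoothness_of_isRCLikeNormedField]; exact ENat.natCast_le_of_coe_top_le_withTop le_rfl 2)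
  simp only [ContinuousLinearMap.coe_comp, Function.comp_apply, curlPairCLM_apply, inner_sub_right,
    inner_smul_right, Finset.sum_sub_distrib]
  have key : ∀ u w : E, ∑ i, fderiv ℝ (fderiv ℝ g) x (b i) u * ⟪b i, w⟫ =
      fderiv ℝ (fderiv ℝ g) x w u := by
    intro u w
    conv_rhs => rw [← b.sum_repr' w]
    rw [map_sum, FunLike.coe_sum, Finset.sum_apply]
    refine Finset.sum_congr rfl fun i _ => ?_
    rw [map_smul, FunLike.coe_smul, Pi.smul_apply, smul_eq_mul, mul_comm]
  rw [key a c, key c a, hsymm c a, sub_self]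

end CurlPair

/-! ### Slices of jointly smooth functions: iterated spatial derivatives -/

section Slice

variable {F : Type*} [NormedAddCommGroup F] [NormedSpace ℝ F]
variable {Φ : ℝ → E → F}

omit [InnerProductSpace ℝ E] [FiniteDimensional ℝ E] in
/-- The iterated spatial derivatives of a slice are the iterated derivatives of the joint function
composed with the inclusion `E → ℝ × E` in every slot. [folklore] -/
theorem iteratedFDeriv_slice_eq [NormedSpace ℝ E] (hΦ : ContDiff ℝ ∞ (uncurry Φ)) (m : ℕ) (t : ℝ) (x : E) :
    iteratedFDeriv ℝ m (Φ t) x = (iteratedFDeriv ℝ m (uncurry Φ) (t, x)).compContinuousLinearMap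
      fun _ => ContinuousLinearMap.inr ℝ ℝ E := by
  set f₁ : ℝ × E → F := fun z => uncurry Φ (((t, 0) : ℝ × E) + z) with hf₁
  have hf₁c : ContDiff ℝ ∞ f₁ := hΦ.comp ((contDiff_const).add contDiff_id)
  have heq : Φ t = f₁ ∘ ⇑(ContinuousLinearMap.inr ℝ ℝ E) := by
    funext y
    simp [hf₁, uncurry]
  rw [heq, ContinuousLinearMap.iteratedFDeriv_comp_right _ hf₁c _ (by exact_mod_cast le_top)]
  congr 1
  rw [hf₁, iteratedFDeriv_comp_add_left]
  simp

omit [InnerProductSpace ℝ E] [FiniteDimensional ℝ E] in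
/-- Joint continuity of the iterated spatial derivatives of the slices of a jointly smooth
function. [folklore] -/
theorem continuous_iteratedFDeriv_slice [NormedSpace ℝ E] (hΦ : ContDiff ℝ ∞ (uncurry Φ)) (m : ℕ) :
    Continuous fun p : ℝ × E => iteratedFDeriv ℝ m (Φ p.1) p.2 := by
  have h1 : Continuous fun p : ℝ × E => iteratedFDeriv ℝ m (uncurry Φ) p :=
    hΦ.continuous_iteratedFDeriv (by exact_mod_cast le_top)
  have h2 : Continuous fun p : ℝ × E =>
      (ContinuousMultilinearMap.compContinuousLinearMapL (fun _ : Fin m => ContinuousLinearMap.inr ℝ ℝ E))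
        (iteratedFDeriv ℝ m (uncurry Φ) p) :=
    (ContinuousMultilinearMap.compContinuousLinearMapL _).continuous.comp h1
  refine h2.congr fun p => ?_
  rw [iteratedFDeriv_slice_eq hΦ m p.1 p.2]
  rfl

omit [InnerProductSpace ℝ E] [FiniteDimensional ℝ E] in
/-- The iterated spatial derivatives of a slice are bounded by those of the joint function. [folklore] -/
theorem norm_iteratedFDeriv_slice_le [NormedSpace ℝ E] (hΦ : ContDiff ℝ ∞ (uncurry Φ)) (m : ℕ) (t : ℝ) (x : E) :
    ‖iteratedFDeriv ℝ m (Φ t) x‖ ≤ ‖iteratedFDeriv ℝ m (uncurry Φ) (t, x)‖ := by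
  rw [iteratedFDeriv_slice_eq hΦ m t x]
  refine (ContinuousMultilinearMap.norm_compContinuousLinearMap_le _ _).trans ?_
  refine mul_le_of_le_one_right (norm_nonneg _) (Finset.prod_le_one (fun _ _ => norm_nonneg _) ?_)
  intro i _
  exact ContinuousLinearMap.norm_inr_le_one ℝ ℝ E

end Slice

/-! ### Iterated derivatives of the radial cut-offs and of cut-off products -/

section Cutoff

/-- **Uniform bounds on the iterated derivatives of the cut-offs**: for every order `m` there is
`C` with `‖Dᵐ(cutoff R)(x)‖ ≤ C` for all `R ≥ 1` and all `x` (chain rule `Dᵐ(χ(·/R)) =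
R⁻ᵐ (Dᵐχ)(·/R)` and boundedness of `Dᵐχ`; in fact `≤ C R⁻ᵐ`). [folklore] -/
theorem exists_norm_iteratedFDeriv_cutoff_le (m : ℕ) :
    ∃ C : ℝ, 0 ≤ C ∧ ∀ R : ℝ, 1 ≤ R → ∀ x : E, ‖iteratedFDeriv ℝ m (cutoff R) x‖ ≤ C := by
  set χ : E → ℝ := ⇑(FunctionSpaces.dyadicCutoff E) with hχ
  have hχc : ContDiff ℝ ∞ χ := (FunctionSpaces.dyadicCutoff E).contDiff
  obtain ⟨C, hC⟩ := (hχc.continuous_iteratedFDeriv (m := m) (by exact_mod_cast le_top))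
    |>.bounded_above_of_compact_support ((FunctionSpaces.dyadicCutoff E).hasCompactSupport.iteratedFDeriv m)
  refine ⟨max C 0, le_max_right _ _, fun R hR x => ?_⟩
  have hR0 : 0 < R := one_pos.trans_le hR
  set g : E →L[ℝ] E := R⁻¹ • ContinuousLinearMap.id ℝ E with hg
  have heq : cutoff R = χ ∘ ⇑g := by
    funext y
    simp [hg, cutoff_apply, hχ]
  rw [heq, ContinuousLinearMap.iteratedFDeriv_comp_right g hχc x (by exact_mod_cast le_top)]
  refine (ContinuousMultilinearMap.norm_compContinuousLinearMap_le _ _).trans ?_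
  have hg1 : ‖g‖ ≤ 1 := by
    rw [hg]
    refine (norm_smul_le (R⁻¹) (ContinuousLinearMap.id ℝ E)).trans ?_
    rw [norm_inv, Real.norm_of_nonneg hR0.le]
    exact mul_le_one₀ (inv_le_one_of_one_le₀ hR) (norm_nonneg _) ContinuousLinearMap.norm_id_le
  calc ‖iteratedFDeriv ℝ m χ (g x)‖ * ∏ _i : Fin m, ‖g‖ ≤ C * 1 := by
        refine mul_le_mul (hC _) (Finset.prod_le_one (fun _ _ => norm_nonneg _) fun _ _ => hg1)
          (Finset.prod_nonneg fun _ _ => norm_nonneg _) ((norm_nonneg _).trans (hC (g x)))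
    _ ≤ max C 0 := by rw [mul_one]; exact le_max_left _ _

variable {F : Type*} [NormedAddCommGroup F] [NormedSpace ℝ F]

omit [InnerProductSpace ℝ E] [FiniteDimensional ℝ E] in
/-- **Leibniz bound for cut-off products.** If `‖Dⁱχ(x)‖ ≤ C` for `i ≤ m`, then
`‖Dᵐ(χ f)(x)‖ ≤ (Σᵢ (m choose i) C) Σ_{k ≤ m} ‖Dᵏf(x)‖`. [folklore] -/
theorem norm_iteratedFDeriv_mul_le_of_le [NormedSpace ℝ E] {χ : E → ℝ} {f : E → ℝ} (hχ : ContDiff ℝ ∞ χ)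
    (hf : ContDiff ℝ ∞ f) {m : ℕ} {C : ℝ} {x : E}
    (hC : ∀ i ≤ m, ‖iteratedFDeriv ℝ i χ x‖ ≤ C) :
    ‖iteratedFDeriv ℝ m (fun y => χ y * f y) x‖ ≤
      (∑ i ∈ Finset.range (m + 1), (m.choose i : ℝ) * C) *
        ∑ k ∈ Finset.range (m + 1), ‖iteratedFDeriv ℝ k f x‖ := by
  have h := norm_iteratedFDeriv_mul_le hχ hf x (n := m) (by exact_mod_cast le_top)
  refine h.trans ?_
  rw [Finset.sum_mul]
  refine Finset.sum_le_sum fun i hi => ?_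
  rw [Finset.mem_range] at hi
  have hCi : ‖iteratedFDeriv ℝ i χ x‖ ≤ C := hC i (Nat.lt_succ_iff.1 hi)
  have hC0 : 0 ≤ C := (norm_nonneg _).trans hCi
  have hk : ‖iteratedFDeriv ℝ (m - i) f x‖ ≤ ∑ k ∈ Finset.range (m + 1), ‖iteratedFDeriv ℝ k f x‖ :=
    Finset.single_le_sum (f := fun k => ‖iteratedFDeriv ℝ k f x‖) (fun _ _ => norm_nonneg _)
      (Finset.mem_range.2 (Nat.lt_succ_of_le (Nat.sub_le m i)))
  calc (m.choose i : ℝ) * ‖iteratedFDeriv ℝ i χ x‖ * ‖iteratedFDeriv ℝ (m - i) f x‖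
      ≤ (m.choose i : ℝ) * C * ∑ k ∈ Finset.range (m + 1), ‖iteratedFDeriv ℝ k f x‖ := by
        gcongr
    _ = (m.choose i : ℝ) * C * ∑ k ∈ Finset.range (m + 1), ‖iteratedFDeriv ℝ k f x‖ := rfl

omit [FiniteDimensional ℝ E] in
/-- The cut-offs equal `1` on the unit ball about any point, eventually along `R = n + 1`. [folklore] -/
theorem eventually_forall_cutoff_eq_one (x : E) :
    ∀ᶠ n : ℕ in atTop, ∀ y ∈ ball x 1, cutoff ((n : ℝ) + 1) y = 1 := by
  obtain ⟨N, hN⟩ := exists_nat_gt (‖x‖ + 1)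
  filter_upwards [eventually_ge_atTop N] with n hn y hy
  refine cutoff_eq_one (by positivity) ?_
  rw [mem_ball, dist_eq_norm] at hy
  have : ‖y‖ ≤ ‖y - x‖ + ‖x‖ := norm_le_norm_sub_add y x
  have hn' : (N : ℝ) ≤ n := by exact_mod_cast hn
  linarith

end Cutoff

/-! ### Jointly smooth scalar fields and their curl-type space–time fields -/

section SpaceTime

variable {F : Type*} [NormedAddCommGroup F] [NormedSpace ℝ F]

omit [InnerProductSpace ℝ E] [FiniteDimensional ℝ E] in
/-- A jointly smooth function is smooth on the whole space–time in the sense of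
`IsSmoothSpaceTimeOn univ`. [folklore] -/
theorem isSmoothSpaceTimeOn_univ_of_contDiff [NormedSpace ℝ E] {Φ : ℝ → E → F} (hΦ : ContDiff ℝ ∞ (uncurry Φ)) :
    IsSmoothSpaceTimeOn univ Φ := by
  rw [IsSmoothSpaceTimeOn, univ_prod_univ, contDiffOn_univ]; exact hΦ

omit [InnerProductSpace ℝ E] [FiniteDimensional ℝ E] in
/-- Conversely, `IsSmoothSpaceTimeOn univ` is joint smoothness. [folklore] -/
theorem contDiff_of_isSmoothSpaceTimeOn_univ [NormedSpace ℝ E] {Φ : ℝ → E → F} (hΦ : IsSmoothSpaceTimeOn univ Φ) :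
    ContDiff ℝ ∞ (uncurry Φ) := by
  rw [IsSmoothSpaceTimeOn, univ_prod_univ, contDiffOn_univ] at hΦ; exact hΦ

omit [InnerProductSpace ℝ E] [FiniteDimensional ℝ E] in
/-- The slices of a jointly smooth function are smooth. [folklore] -/
theorem contDiff_slice_of_contDiff_uncurry [NormedSpace ℝ E] {Φ : ℝ → E → F} (hΦ : ContDiff ℝ ∞ (uncurry Φ)) (t : ℝ) :
    ContDiff ℝ ∞ (Φ t) :=
  hΦ.comp (contDiff_prodMk_right t)

omit [InnerProductSpace ℝ E] [FiniteDimensional ℝ E] in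
/-- The operator-valued slice derivative of a jointly smooth function is jointly smooth. [folklore] -/
theorem contDiff_uncurry_fderiv_slice [NormedSpace ℝ E] {Φ : ℝ → E → F} (hΦ : ContDiff ℝ ∞ (uncurry Φ)) :
    ContDiff ℝ ∞ (uncurry fun t x => fderiv ℝ (Φ t) x) :=
  contDiff_of_isSmoothSpaceTimeOn_univ
    ((isSmoothSpaceTimeOn_univ_of_contDiff hΦ).isSmoothSpaceTimeOn_fderiv_of_isOpen isOpen_univ)

omit [InnerProductSpace ℝ E] [FiniteDimensional ℝ E] in
/-- The time derivative of a jointly smooth function is jointly smooth. [folklore] -/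
theorem contDiff_uncurry_timeDeriv [NormedSpace ℝ E] {Φ : ℝ → E → F} (hΦ : ContDiff ℝ ∞ (uncurry Φ)) :
    ContDiff ℝ ∞ (uncurry (timeDeriv Φ)) :=
  contDiff_of_isSmoothSpaceTimeOn_univ
    ((isSmoothSpaceTimeOn_univ_of_contDiff hΦ).isSmoothSpaceTimeOn_deriv isOpen_univ)

variable {Φ : ℝ → E → ℝ} {a c : E}

omit [FiniteDimensional ℝ E] in
/-- The curl-type space–time field of a jointly smooth scalar function is jointly smooth. [folklore] -/
theorem contDiff_uncurry_curlPair (hΦ : ContDiff ℝ ∞ (uncurry Φ)) :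
    ContDiff ℝ ∞ (uncurry fun t x => 𝐋[a, c] (fderiv ℝ (Φ t) x)) :=
  (𝐋[a, c]).contDiff.comp (contDiff_uncurry_fderiv_slice hΦ)

omit [FiniteDimensional ℝ E] in
/-- The curl-type field vanishes outside the support of the scalar function. [folklore] -/
theorem curlPair_eq_zero_of_notMem_tsupport {t : ℝ} {x : E} (h : (t, x) ∉ tsupport (uncurry Φ)) :
    𝐋[a, c] (fderiv ℝ (Φ t) x) = 0 := by
  have h0 : uncurry Φ =ᶠ[𝓝 (t, x)] 0 := notMem_tsupport_iff_eventuallyEq.1 h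
  have hc : Continuous fun y : E => (t, y) := continuous_const.prodMk continuous_id
  have h1 : Φ t =ᶠ[𝓝 x] fun _ => (0 : ℝ) := (hc.tendsto x).eventually h0
  rw [h1.fderiv_eq, fderiv_fun_const, Pi.zero_apply, map_zero]

omit [FiniteDimensional ℝ E] in
/-- The support of the curl-type field is contained in that of the scalar function. [folklore] -/
theorem tsupport_curlPair_subset :
    tsupport (uncurry fun t x => 𝐋[a, c] (fderiv ℝ (Φ t) x)) ⊆ tsupport (uncurry Φ) := by
  refine closure_minimal (fun p hp => ?_) (isClosed_tsupport _)
  by_contra h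
  obtain ⟨t, x⟩ := p
  exact hp (curlPair_eq_zero_of_notMem_tsupport h)

omit [FiniteDimensional ℝ E] in
/-- **Curl-type fields of space–time test functions are space–time test fields.** [folklore] -/
theorem isSpaceTimeTestOn_curlPair {Q : Opens (ℝ × E)} (hΦ : IsSpaceTimeTestOn Q Φ) :
    IsSpaceTimeTestOn Q (fun t x => 𝐋[a, c] (fderiv ℝ (Φ t) x)) where
  contDiff := contDiff_uncurry_curlPair hΦ.contDiff
  hasCompactSupport :=
    IsCompact.of_isClosed_subset hΦ.hasCompactSupport (isClosed_tsupport _) tsupport_curlPair_subset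
  tsupport_subset := tsupport_curlPair_subset.trans hΦ.tsupport_subset

/-- **Curl-type fields are divergence free** at every time. [folklore] -/
theorem isDivFree_curlPair (hΦ : ContDiff ℝ ∞ (uncurry Φ)) (t : ℝ) :
    VectorCalculus.IsDivFree (fun x => 𝐋[a, c] (fderiv ℝ (Φ t) x)) := fun x =>
  divergence_curlPair_eq_zero (contDiff_slice_of_contDiff_uncurry hΦ t) x

omit [FiniteDimensional ℝ E] in
/-- **The time derivative falls on the scalar function**: `∂ₜ(𝐋 ∘ D(Φ t)) = 𝐋 ∘ D(∂ₜΦ t)`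
(exchange of `∂ₜ` and `D`, Schwarz). [folklore] -/
theorem timeDeriv_curlPair (hΦ : ContDiff ℝ ∞ (uncurry Φ)) (t : ℝ) (x : E) :
    timeDeriv (fun t x => 𝐋[a, c] (fderiv ℝ (Φ t) x)) t x = 𝐋[a, c] (fderiv ℝ (timeDeriv Φ t) x) := by
  have hd := (isSmoothSpaceTimeOn_univ_of_contDiff hΦ).hasDerivAt_fderiv_slice_clm isOpen_univ
    (mem_univ t) x
  rw [timeDeriv_apply]
  exact ((𝐋[a, c]).hasFDerivAt.comp_hasDerivAt t hd).deriv

/-! #### Cut-off products -/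

omit [FiniteDimensional ℝ E] in
/-- Cut-off products of jointly smooth scalar functions are jointly smooth. [folklore] -/
theorem contDiff_uncurry_cutoff_mul (hΦ : ContDiff ℝ ∞ (uncurry Φ)) (R : ℝ) :
    ContDiff ℝ ∞ (uncurry fun t x => cutoff R x * Φ t x) :=
  ((contDiff_cutoff R).comp contDiff_snd).mul hΦ

omit [FiniteDimensional ℝ E] in
/-- The time derivative of a cut-off product: `∂ₜ(χ Φ) = χ ∂ₜΦ`. [folklore] -/
theorem timeDeriv_cutoff_mul (R : ℝ) (t : ℝ) :
    timeDeriv (fun t x => cutoff R x * Φ t x) t = fun x => cutoff R x * timeDeriv Φ t x := by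
  funext x
  simp only [timeDeriv_apply]
  exact congrFun (deriv_const_mul_field' (𝕜 := ℝ) (v := fun s => Φ s x) (cutoff R x)) t

/-- **Cut-off products of time-compactly supported smooth functions are space–time test functions
on the slab `t < T`**: if `Φ` is jointly smooth and `Φ(t) = 0` for `t ∉ [t₀, b]` with `b < T`,
then `χ_R Φ` is a space–time test function on `(-∞, T) × E` for every `R > 0`. [folklore] -/
theorem isSpaceTimeTestOn_cutoff_mul (hΦ : ContDiff ℝ ∞ (uncurry Φ)) {t₀ b T : ℝ} (hbT : b < T)
    (hsupp : ∀ t, t ∉ Icc t₀ b → Φ t = 0) {R : ℝ} (hR : 0 < R) :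
    IsSpaceTimeTestOn (slab E (Iio T) isOpen_Iio) (fun t x => cutoff R x * Φ t x) := by
  have hsub : tsupport (uncurry fun t x => cutoff R x * Φ t x) ⊆ Icc t₀ b ×ˢ closedBall (0 : E) (2 * R) := by
    refine closure_minimal (fun p hp => ?_) (isClosed_Icc.prod isClosed_closedBall)
    obtain ⟨t, x⟩ := p
    rw [mem_support] at hp
    refine ⟨?_, ?_⟩
    · by_contra ht
      exact hp (by simp [uncurry, hsupp t ht])
    · by_contra hx
      rw [mem_closedBall, dist_zero_right, not_le] at hx
      exact hp (by simp [uncurry, cutoff_eq_zero hR hx.le])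
  refine ⟨contDiff_uncurry_cutoff_mul hΦ R, ?_, ?_⟩
  · exact IsCompact.of_isClosed_subset (isCompact_Icc.prod (isCompact_closedBall _ _))
      (isClosed_tsupport _) hsub
  · intro p hp
    rw [SetLike.mem_coe, mem_slab]
    exact lt_of_le_of_lt (hsub hp).1.2 hbT

omit [FiniteDimensional ℝ E] in
/-- **Eventual local equality.** Along `R = n + 1` the cut-off products agree with `Φ` at all
times and all points of the unit ball about any given `x`, eventually. [folklore] -/
theorem eventually_forall_cutoff_mul_eq (Φ : ℝ → E → ℝ) (x : E) :
    ∀ᶠ n : ℕ in atTop, ∀ s, ∀ y ∈ ball x 1, cutoff ((n : ℝ) + 1) y * Φ s y = Φ s y := by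
  filter_upwards [eventually_forall_cutoff_eq_one x] with n hn s y hy
  rw [hn y hy, one_mul]

end SpaceTime

/-! ### Measure-theoretic preliminaries on the slab `(0, T) × E` -/

section Slab

variable [MeasurableSpace E] [BorelSpace E]

/-- The Hölder triple `(4, 4/3, 1)`: `1/4 + 3/4 = 1`. [folklore] -/
theorem holderTriple_four_fourThirds : ENNReal.HolderTriple 4 (4 / 3) 1 := by
  refine ⟨?_⟩
  rw [inv_one, ENNReal.inv_div (Or.inr (by norm_num)) (Or.inr (by norm_num))]
  rw [show (3 : ℝ≥0∞) / 4 = 3 * 4⁻¹ from div_eq_mul_inv _ _]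
  calc (4 : ℝ≥0∞)⁻¹ + 3 * 4⁻¹ = (1 + 3) * 4⁻¹ := by ring
    _ = 4 * 4⁻¹ := by norm_num
    _ = 1 := ENNReal.mul_inv_cancel (by norm_num) (by norm_num)

omit [InnerProductSpace ℝ E] [FiniteDimensional ℝ E] [MeasurableSpace E] [BorelSpace E] in
/-- `L⁴ × L^{4/3} ⊂ L¹`: `‖f‖ h` is integrable for `f ∈ L⁴`, `h ∈ L^{4/3}` (real `h`). [folklore] -/
theorem integrable_norm_mul_of_four_fourThirds {α : Type*} [MeasurableSpace α] {μ : Measure α}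
    {G : Type*} [NormedAddCommGroup G] {f : α → G} {h : α → ℝ} (hf : MemLp f 4 μ)
    (hh : MemLp h (4 / 3) μ) : Integrable (fun z => ‖f z‖ * h z) μ := by
  haveI := holderTriple_four_fourThirds
  exact hf.norm.integrable_mul hh

omit [InnerProductSpace ℝ E] [FiniteDimensional ℝ E] [MeasurableSpace E] [BorelSpace E] in
/-- `‖f‖² h` is integrable for `f ∈ L⁴`, `h ∈ L²` (real `h`). [folklore] -/
theorem integrable_norm_sq_mul_of_four_two {α : Type*} [MeasurableSpace α] {μ : Measure α}
    {G : Type*} [NormedAddCommGroup G] {f : α → G} {h : α → ℝ} (hf : MemLp f 4 μ)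
    (hh : MemLp h 2 μ) : Integrable (fun z => ‖f z‖ ^ 2 * h z) μ := by
  have h2 : MemLp (fun z => ‖f z‖ ^ 2) 2 μ := by
    have h := hf.norm_rpow_div 2
    have h42 : (4 : ℝ≥0∞) / 2 = 2 :=
      ((ENNReal.eq_div_iff (by norm_num) (by norm_num)).2 (by norm_num)).symm
    rw [h42] at h
    refine h.congr_norm (hf.1.norm.pow 2) (Eventually.of_forall fun z => ?_)
    simp
  exact h2.integrable_mul hh

/-- **From the mixed class `L⁴(0,T; L⁴)` to `L⁴` of the slab.** [folklore] -/
theorem eLpNorm_uncurry_lt_top_of_memLqLp_four {G : Type*} [NormedAddCommGroup G] {T : ℝ}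
    {v : ℝ → E → G}
    (hm : AEStronglyMeasurable (uncurry v) ((volume.restrict (Ioo 0 T)).prod (volume : Measure E)))
    (h4 : MemLqLp 4 4 v (Ioo 0 T)) :
    eLpNorm (uncurry v) 4 ((volume.restrict (Ioo 0 T)).prod (volume : Measure E)) < ⊤ := by
  have h40 : (4 : ℝ≥0∞) ≠ 0 := by norm_num
  have h4t : (4 : ℝ≥0∞) ≠ ⊤ := by norm_num
  have h4r : (4 : ℝ≥0∞).toReal = 4 := by norm_num
  rw [eLpNorm_lt_top_iff_lintegral_rpow_enorm_lt_top h40 h4t, h4r,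
    lintegral_prod _ (hm.enorm.pow_const _)]
  have hslice : ∀ t, ∫⁻ x, ‖uncurry v (t, x)‖ₑ ^ (4 : ℝ) = eLpNorm (v t) 4 volume ^ (4 : ℝ) := by
    intro t
    have := lintegral_rpow_enorm_eq_rpow_eLpNorm' (μ := (volume : Measure E)) (f := v t)
      (q := 4) (by norm_num)
    rw [eLpNorm_eq_eLpNorm' h40 h4t, h4r]
    exact this
  simp_rw [hslice]
  have hae : ∀ᵐ t ∂(volume.restrict (Ioo 0 T)),
      eLpNorm (v t) 4 volume ^ (4 : ℝ) = ‖(eLpNorm (v t) 4 volume).toReal‖ₑ ^ (4 : ℝ) := by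
    filter_upwards [h4.1] with t ht
    rw [Real.enorm_eq_ofReal ENNReal.toReal_nonneg, ENNReal.ofReal_toReal ht.eLpNorm_ne_top]
  rw [lintegral_congr_ae hae]
  have h := h4.2
  rw [eLqLpNorm, eLpNorm_lt_top_iff_lintegral_rpow_enorm_lt_top h40 h4t, h4r] at h
  exact h

/-- The joint measurability clause of a weak solution, in product form. [folklore] -/
theorem aestronglyMeasurable_uncurry_prod_of_restrict {G : Type*} [TopologicalSpace G] {T : ℝ}
    {v : ℝ → E → G}
    (hm : AEStronglyMeasurable (uncurry v) (volume.restrict (Ioo 0 T ×ˢ univ))) :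
    AEStronglyMeasurable (uncurry v) ((volume.restrict (Ioo 0 T)).prod (volume : Measure E)) := by
  rw [Measure.volume_eq_prod, ← Measure.prod_restrict, Measure.restrict_univ] at hm
  exact hm

end Slab

/-! ### The extension theorem -/

section Extension

variable [MeasurableSpace E] [BorelSpace E]

/-- Measurability of the weak-formulation integrand built from a jointly smooth test field and a
jointly measurable velocity. [folklore] -/
theorem aestronglyMeasurable_weakIntegrand {μ : Measure (ℝ × E)} {V : ℝ × E → E}
    (hV : AEStronglyMeasurable V μ) {Θ : ℝ → E → E} (hΘ : ContDiff ℝ ∞ (uncurry Θ)) (ν : ℝ) :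
    AEStronglyMeasurable (fun p : ℝ × E => ⟪V p, timeDeriv Θ p.1 p.2⟫ +
      ⟪V p, fderiv ℝ (Θ p.1) p.2 (V p)⟫ + ν * ⟪V p, Δ (Θ p.1) p.2⟫) μ := by
  have h1 : Continuous fun p : ℝ × E => timeDeriv Θ p.1 p.2 :=
    (contDiff_uncurry_timeDeriv hΘ).continuous
  have h2 : Continuous fun p : ℝ × E => fderiv ℝ (Θ p.1) p.2 :=
    (contDiff_uncurry_fderiv_slice hΘ).continuous
  have h3 : Continuous fun p : ℝ × E => Δ (Θ p.1) p.2 := by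
    have h := (isSmoothSpaceTimeOn_univ_of_contDiff hΘ).laplacian uniqueDiffOn_univ
    exact (contDiff_of_isSmoothSpaceTimeOn_univ h).continuous
  have h2' : AEStronglyMeasurable (fun p => fderiv ℝ (Θ p.1) p.2 (V p)) μ :=
    (isBoundedBilinearMap_apply (𝕜 := ℝ) (E := E) (F := E)).continuous.comp_aestronglyMeasurable
      (h2.aestronglyMeasurable.prodMk hV)
  exact ((hV.inner h1.aestronglyMeasurable).add (hV.inner h2')).add
    ((hV.inner h3.aestronglyMeasurable).const_mul ν)

/-- **Extension of the weak formulation to curl-type test fields without compact spatial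
support.** Let `v` be a distributional (pressure-free, divergence-free-tested) solution of the
unforced Navier–Stokes system on `E × [0, T)` with datum `v₀ ∈ L²` (accepted
`Fluid.IsWeakNSSolutionOn T ν 0 v₀ v`) lying in `L⁴` of the slab `(0, T) × E`. Let `Ψ` be a
jointly smooth scalar function vanishing for `t ∉ [t₀, b]`, `b < T`, whose spatial derivatives of
orders `≤ 3` lie in `L^{4/3}` of the slab, of orders `≤ 2` in `L²` of the slab, whose time
derivative has spatial derivatives of orders `≤ 1` in `L^{4/3}` of the slab, and with
`Ψ(0), DΨ(0) ∈ L²(E)`. Then the weak formulation holds for the (divergence-free, in general not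
compactly supported in space) field `ψ = (∂ₐΨ) c - (∂_cΨ) a`:
`∫₀ᵀ ∫ (⟪v, ∂ₜψ⟫ + ⟪v, (v·∇)ψ⟫ + ν ⟪v, Δψ⟫) + ∫ ⟪v₀, ψ(0)⟫ = 0`.
Proof: the identity holds for the honest test fields `ψ_R = (∂ₐ(χ_RΨ)) c - (∂_c(χ_RΨ)) a`
(`χ_R` the radial cut-offs), which are divergence free by the symmetry of second derivatives, and
passes to the limit `R → ∞` by dominated convergence: pointwise `ψ_R` and its derivatives
eventually coincide with those of `ψ`, and the Leibniz rule with `‖Dᵏχ_R‖ ≤ C` (`R ≥ 1`) bounds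
every term by an integrable majorant built from `|v| |D^{≤1}∂ₜΨ|`, `|v|² |D^{≤2}Ψ|`,
`|v| |D^{≤3}Ψ|` (Hölder `L⁴ × L^{4/3}`, `L² × L²`). This is the density step by which duality
arguments test very weak `L⁴(Q_T)` solutions against adjoint heat/Stokes flows (cf. Galdi 2019,
proof of Thm. 1.1, (2.12), where the analogous extension is Lemma A.1). [cite: Galdi2018, proof of Thm. 1.1, (2.12) and Lemma A.1] -/
theorem IsWeakNSSolutionOn.weakForm_curlPair_extended
    {T ν : ℝ} {v₀ : E → E} {v : ℝ → E → E} (hw : IsWeakNSSolutionOn T ν 0 v₀ v)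
    (hv₀ : MemLp v₀ 2 volume)
    (hv4 : eLpNorm (uncurry v) 4 ((volume.restrict (Ioo 0 T)).prod (volume : Measure E)) < ⊤)
    {Ψ : ℝ → E → ℝ} (hΨ : ContDiff ℝ ∞ (uncurry Ψ)) {t₀ b : ℝ} (hbT : b < T)
    (hsupp : ∀ t, t ∉ Icc t₀ b → Ψ t = 0)
    (h43 : ∀ k ≤ 3, eLpNorm (fun p : ℝ × E => iteratedFDeriv ℝ k (Ψ p.1) p.2) (4 / 3)
      ((volume.restrict (Ioo 0 T)).prod (volume : Measure E)) < ⊤)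
    (h2 : ∀ k ≤ 2, eLpNorm (fun p : ℝ × E => iteratedFDeriv ℝ k (Ψ p.1) p.2) 2
      ((volume.restrict (Ioo 0 T)).prod (volume : Measure E)) < ⊤)
    (ht43 : ∀ k ≤ 1, eLpNorm (fun p : ℝ × E => iteratedFDeriv ℝ k (timeDeriv Ψ p.1) p.2) (4 / 3)
      ((volume.restrict (Ioo 0 T)).prod (volume : Measure E)) < ⊤)
    (h0 : ∀ k ≤ 1, eLpNorm (fun x => iteratedFDeriv ℝ k (Ψ 0) x) 2 (volume : Measure E) < ⊤)
    (a c : E) {ψ : ℝ → E → E}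
    (hψ : ∀ t x, ψ t x = (fderiv ℝ (Ψ t) x a) • c - (fderiv ℝ (Ψ t) x c) • a) :
    (∫ t in Ioo 0 T, ∫ x, (⟪v t x, timeDeriv ψ t x⟫ + ⟪v t x, convect (v t) (ψ t) x⟫ +
        ν * ⟪v t x, Δ (ψ t) x⟫)) + ∫ x, ⟪v₀ x, ψ 0 x⟫ = 0 := by
  -- ### notation and the cut-off approximants
  obtain rfl : ψ = fun t x => 𝐋[a, c] (fderiv ℝ (Ψ t) x) := by
    funext t x; rw [hψ, curlPairCLM_apply]
  set μ : Measure (ℝ × E) := (volume.restrict (Ioo 0 T)).prod (volume : Measure E) with hμ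
  set Φ : ℕ → ℝ → E → ℝ := fun n t x => cutoff ((n : ℝ) + 1) x * Ψ t x with hΦ_def
  set ψn : ℕ → ℝ → E → E := fun n t x => 𝐋[a, c] (fderiv ℝ (Φ n t) x) with hψn_def
  have hn1 : ∀ n : ℕ, (1 : ℝ) ≤ (n : ℝ) + 1 := fun n => by
    have : (0 : ℝ) ≤ n := n.cast_nonneg
    linarith
  have hΦs : ∀ n, ContDiff ℝ ∞ (uncurry (Φ n)) := fun n => contDiff_uncurry_cutoff_mul hΨ _
  have hψns : ∀ n, ContDiff ℝ ∞ (uncurry (ψn n)) := fun n => contDiff_uncurry_curlPair (hΦs n)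
  have hψs : ContDiff ℝ ∞ (uncurry fun t x => 𝐋[a, c] (fderiv ℝ (Ψ t) x)) :=
    contDiff_uncurry_curlPair hΨ
  have htest : ∀ n, IsSpaceTimeTestOn (slab E (Iio T) isOpen_Iio) (ψn n) := fun n =>
    isSpaceTimeTestOn_curlPair (isSpaceTimeTestOn_cutoff_mul hΨ hbT hsupp (by positivity))
  have hdiv : ∀ n t, VectorCalculus.IsDivFree (ψn n t) := fun n t => isDivFree_curlPair (hΦs n) t
  -- ### the weak formulation for the approximants
  have hweak : ∀ n, (∫ t in Ioo 0 T, ∫ x, (⟪v t x, timeDeriv (ψn n) t x⟫ +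
      ⟪v t x, convect (v t) (ψn n t) x⟫ + ν * ⟪v t x, Δ (ψn n t) x⟫)) +
      ∫ x, ⟪v₀ x, ψn n 0 x⟫ = 0 := by
    intro n
    have h := hw.2.2.2 (ψn n) (htest n) (hdiv n)
    simpa only [Pi.zero_apply, inner_zero_left, add_zero] using h
  -- ### cut-off constants
  obtain ⟨C₀, hC₀0, hC₀⟩ := exists_norm_iteratedFDeriv_cutoff_le (E := E) 0
  obtain ⟨C₁, hC₁0, hC₁⟩ := exists_norm_iteratedFDeriv_cutoff_le (E := E) 1
  obtain ⟨C₂, hC₂0, hC₂⟩ := exists_norm_iteratedFDeriv_cutoff_le (E := E) 2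
  obtain ⟨C₃, hC₃0, hC₃⟩ := exists_norm_iteratedFDeriv_cutoff_le (E := E) 3
  set C : ℝ := max (max C₀ C₁) (max C₂ C₃) with hC_def
  have hCall : ∀ i ≤ 3, ∀ n : ℕ, ∀ x : E, ‖iteratedFDeriv ℝ i (cutoff ((n : ℝ) + 1)) x‖ ≤ C := by
    intro i hi n x
    interval_cases i
    · exact (hC₀ _ (hn1 n) x).trans ((le_max_left _ _).trans (le_max_left _ _))
    · exact (hC₁ _ (hn1 n) x).trans ((le_max_right _ _).trans (le_max_left _ _))
    · exact (hC₂ _ (hn1 n) x).trans ((le_max_left _ _).trans (le_max_right _ _))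
    · exact (hC₃ _ (hn1 n) x).trans ((le_max_right _ _).trans (le_max_right _ _))
  -- Leibniz constants and sums of derivative norms
  set K : ℕ → ℝ := fun m => ∑ i ∈ Finset.range (m + 1), (m.choose i : ℝ) * C with hK_def
  set S : ℕ → ℝ × E → ℝ := fun m p => ∑ k ∈ Finset.range (m + 1), ‖iteratedFDeriv ℝ k (Ψ p.1) p.2‖
    with hS_def
  set S' : ℝ × E → ℝ := fun p => ∑ k ∈ Finset.range 2, ‖iteratedFDeriv ℝ k (timeDeriv Ψ p.1) p.2‖
    with hS'_def
  have hLeib : ∀ n (m : ℕ), m ≤ 3 → ∀ t x,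
      ‖iteratedFDeriv ℝ m (Φ n t) x‖ ≤ K m * S m (t, x) := by
    intro n m hm t x
    exact norm_iteratedFDeriv_mul_le_of_le (contDiff_cutoff _) (contDiff_slice_of_contDiff_uncurry hΨ t)
      (fun i hi => hCall i (hi.trans hm) n x)
  have hLeib' : ∀ n t x, ‖iteratedFDeriv ℝ 1 (timeDeriv (Φ n) t) x‖ ≤ K 1 * S' (t, x) := by
    intro n t x
    rw [show timeDeriv (Φ n) t = fun x => cutoff ((n : ℝ) + 1) x * timeDeriv Ψ t x from
      timeDeriv_cutoff_mul _ _]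
    exact norm_iteratedFDeriv_mul_le_of_le (contDiff_cutoff _)
      (contDiff_slice_of_contDiff_uncurry (contDiff_uncurry_timeDeriv hΨ) t)
      (fun i hi => hCall i (hi.trans (by norm_num)) n x)
  -- ### integrability of the sums of derivative norms
  have hS3 : MemLp (S 3) (4 / 3) μ :=
    memLp_finsetSum _ fun k hk => (MemLp.norm ⟨(continuous_iteratedFDeriv_slice hΨ k).aestronglyMeasurable,
      h43 k (Nat.lt_succ_iff.1 (Finset.mem_range.1 hk))⟩)
  have hS2 : MemLp (S 2) 2 μ :=
    memLp_finsetSum _ fun k hk => (MemLp.norm ⟨(continuous_iteratedFDeriv_slice hΨ k).aestronglyMeasurable,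
      h2 k (Nat.lt_succ_iff.1 (Finset.mem_range.1 hk))⟩)
  have hS'm : MemLp S' (4 / 3) μ :=
    memLp_finsetSum _ fun k hk => (MemLp.norm
      ⟨(continuous_iteratedFDeriv_slice (contDiff_uncurry_timeDeriv hΨ) k).aestronglyMeasurable,
      ht43 k (Nat.lt_succ_iff.1 (Finset.mem_range.1 hk))⟩)
  -- ### the velocity on the slab
  set V : ℝ × E → E := uncurry v with hV_def
  have hVm : AEStronglyMeasurable V μ := aestronglyMeasurable_uncurry_prod_of_restrict hw.1
  have hV4 : MemLp V 4 μ := ⟨hVm, hv4⟩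
  -- ### the integrands and the majorant
  set Fn : ℕ → ℝ × E → ℝ := fun n p => ⟪V p, timeDeriv (ψn n) p.1 p.2⟫ +
    ⟪V p, fderiv ℝ (ψn n p.1) p.2 (V p)⟫ + ν * ⟪V p, Δ (ψn n p.1) p.2⟫ with hFn_def
  set F : ℝ × E → ℝ := fun p => ⟪V p, timeDeriv (fun t x => 𝐋[a, c] (fderiv ℝ (Ψ t) x)) p.1 p.2⟫ +
    ⟪V p, fderiv ℝ (fun x => 𝐋[a, c] (fderiv ℝ (Ψ p.1) x)) p.2 (V p)⟫ +
    ν * ⟪V p, Δ (fun x => 𝐋[a, c] (fderiv ℝ (Ψ p.1) x)) p.2⟫ with hF_def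
  set A : ℝ := 2 * ‖a‖ * ‖c‖ with hA_def
  set G : ℝ × E → ℝ := fun p => A * K 1 * (‖V p‖ * S' p) + A * K 2 * (‖V p‖ ^ 2 * S 2 p) +
    |ν| * (A * (Module.finrank ℝ E) * K 3) * (‖V p‖ * S 3 p) with hG_def
  have hGint : Integrable G μ := by
    refine ((Integrable.const_mul ?_ _).add (Integrable.const_mul ?_ _)).add (Integrable.const_mul ?_ _)
    · exact integrable_norm_mul_of_four_fourThirds hV4 hS'm
    · exact integrable_norm_sq_mul_of_four_two hV4 hS2
    · exact integrable_norm_mul_of_four_fourThirds hV4 hS3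
  have hFn_meas : ∀ n, AEStronglyMeasurable (Fn n) μ := fun n =>
    aestronglyMeasurable_weakIntegrand hVm (hψns n) ν
  have hF_meas : AEStronglyMeasurable F μ := aestronglyMeasurable_weakIntegrand hVm hψs ν
  -- ### the pointwise bound
  have hbound : ∀ n p, ‖Fn n p‖ ≤ G p := by
    intro n p
    obtain ⟨t, x⟩ := p
    have hΦnt : ContDiff ℝ ∞ (Φ n t) := contDiff_slice_of_contDiff_uncurry (hΦs n) t
    -- the three test-field quantities
    have e1 : ‖timeDeriv (ψn n) t x‖ ≤ A * K 1 * S' (t, x) := by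
      rw [show timeDeriv (ψn n) t x = 𝐋[a, c] (fderiv ℝ (timeDeriv (Φ n) t) x) from
        timeDeriv_curlPair (hΦs n) t x]
      calc ‖𝐋[a, c] (fderiv ℝ (timeDeriv (Φ n) t) x)‖
          ≤ 2 * ‖a‖ * ‖c‖ * ‖iteratedFDeriv ℝ 1 (timeDeriv (Φ n) t) x‖ := norm_curlPair_le x
        _ ≤ 2 * ‖a‖ * ‖c‖ * (K 1 * S' (t, x)) := by gcongr; exact hLeib' n t x
        _ = A * K 1 * S' (t, x) := by rw [hA_def]; ring
    have e2 : ‖fderiv ℝ (ψn n t) x‖ ≤ A * K 2 * S 2 (t, x) := by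
      calc ‖fderiv ℝ (ψn n t) x‖ ≤ 2 * ‖a‖ * ‖c‖ * ‖iteratedFDeriv ℝ 2 (Φ n t) x‖ :=
            norm_fderiv_curlPair_le hΦnt x
        _ ≤ 2 * ‖a‖ * ‖c‖ * (K 2 * S 2 (t, x)) := by gcongr; exact hLeib n 2 (by norm_num) t x
        _ = A * K 2 * S 2 (t, x) := by rw [hA_def]; ring
    have e3 : ‖Δ (ψn n t) x‖ ≤ A * (Module.finrank ℝ E) * K 3 * S 3 (t, x) := by
      calc ‖Δ (ψn n t) x‖ ≤ 2 * ‖a‖ * ‖c‖ * (Module.finrank ℝ E) * ‖iteratedFDeriv ℝ 3 (Φ n t) x‖ :=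
            norm_laplacian_curlPair_le hΦnt x
        _ ≤ 2 * ‖a‖ * ‖c‖ * (Module.finrank ℝ E) * (K 3 * S 3 (t, x)) := by
            gcongr; exact hLeib n 3 le_rfl t x
        _ = A * (Module.finrank ℝ E) * K 3 * S 3 (t, x) := by rw [hA_def]; ring
    -- assemble
    have i1 : ‖⟪V (t, x), timeDeriv (ψn n) t x⟫‖ ≤ A * K 1 * (‖V (t, x)‖ * S' (t, x)) := by
      refine (norm_inner_le_norm _ _).trans ?_
      calc ‖V (t, x)‖ * ‖timeDeriv (ψn n) t x‖ ≤ ‖V (t, x)‖ * (A * K 1 * S' (t, x)) := by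
            gcongr
        _ = A * K 1 * (‖V (t, x)‖ * S' (t, x)) := by ring
    have i2 : ‖⟪V (t, x), fderiv ℝ (ψn n t) x (V (t, x))⟫‖ ≤ A * K 2 * (‖V (t, x)‖ ^ 2 * S 2 (t, x)) := by
      refine (norm_inner_le_norm _ _).trans ?_
      calc ‖V (t, x)‖ * ‖fderiv ℝ (ψn n t) x (V (t, x))‖
          ≤ ‖V (t, x)‖ * (‖fderiv ℝ (ψn n t) x‖ * ‖V (t, x)‖) := by
            gcongr; exact ContinuousLinearMap.le_opNorm _ _
        _ ≤ ‖V (t, x)‖ * ((A * K 2 * S 2 (t, x)) * ‖V (t, x)‖) := by gcongr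
        _ = A * K 2 * (‖V (t, x)‖ ^ 2 * S 2 (t, x)) := by ring
    have i3 : ‖ν * ⟪V (t, x), Δ (ψn n t) x⟫‖ ≤
        |ν| * (A * (Module.finrank ℝ E) * K 3) * (‖V (t, x)‖ * S 3 (t, x)) := by
      rw [norm_mul, Real.norm_eq_abs, mul_assoc]
      refine mul_le_mul_of_nonneg_left ?_ (abs_nonneg ν)
      refine (norm_inner_le_norm _ _).trans ?_
      calc ‖V (t, x)‖ * ‖Δ (ψn n t) x‖ ≤ ‖V (t, x)‖ * (A * (Module.finrank ℝ E) * K 3 * S 3 (t, x)) := by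
            gcongr
        _ = (A * (Module.finrank ℝ E) * K 3) * (‖V (t, x)‖ * S 3 (t, x)) := by ring
    calc ‖Fn n (t, x)‖ ≤ ‖⟪V (t, x), timeDeriv (ψn n) t x⟫‖ +
          ‖⟪V (t, x), fderiv ℝ (ψn n t) x (V (t, x))⟫‖ + ‖ν * ⟪V (t, x), Δ (ψn n t) x⟫‖ :=
          norm_add₃_le
      _ ≤ G (t, x) := by
          simp only [hG_def]
          exact add_le_add (add_le_add i1 i2) i3
  -- ### pointwise convergence: the integrands are eventually equal
  have hlim : ∀ p, Tendsto (fun n => Fn n p) atTop (𝓝 (F p)) := by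
    intro p
    obtain ⟨t, x⟩ := p
    refine tendsto_const_nhds.congr' ?_
    filter_upwards [eventually_forall_cutoff_mul_eq Ψ x] with n hn
    -- local equality of the test fields at all times near `x`
    have hloc : ∀ s, ∀ y ∈ ball x 1, ψn n s y = 𝐋[a, c] (fderiv ℝ (Ψ s) y) := by
      intro s y hy
      have hev : Φ n s =ᶠ[𝓝 y] Ψ s := by
        filter_upwards [isOpen_ball.mem_nhds hy] with z hz
        exact hn s z hz
      show 𝐋[a, c] (fderiv ℝ (Φ n s) y) = 𝐋[a, c] (fderiv ℝ (Ψ s) y)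
      rw [hev.fderiv_eq]
    have hloc' : ∀ s, ψn n s =ᶠ[𝓝 x] fun y => 𝐋[a, c] (fderiv ℝ (Ψ s) y) := fun s => by
      filter_upwards [isOpen_ball.mem_nhds (mem_ball_self one_pos)] with y hy
      exact hloc s y hy
    have q1 : timeDeriv (ψn n) t x = timeDeriv (fun t x => 𝐋[a, c] (fderiv ℝ (Ψ t) x)) t x := by
      simp only [timeDeriv_apply]
      congr 1
      funext s
      exact hloc s x (mem_ball_self one_pos)
    have q2 : fderiv ℝ (ψn n t) x = fderiv ℝ (fun y => 𝐋[a, c] (fderiv ℝ (Ψ t) y)) x :=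
      (hloc' t).fderiv_eq
    have q3 : Δ (ψn n t) x = Δ (fun y => 𝐋[a, c] (fderiv ℝ (Ψ t) y)) x :=
      (laplacian_congr_nhds (hloc' t)).eq_of_nhds
    simp only [hFn_def, hF_def, q1, q2, q3]
  -- ### dominated convergence on the slab
  have hFint : ∀ n, Integrable (Fn n) μ := fun n =>
    hGint.mono' (hFn_meas n) (Eventually.of_forall (hbound n))
  have hFint' : Integrable F μ := by
    refine hGint.mono' hF_meas (Eventually.of_forall fun p => ?_)
    exact le_of_tendsto' ((hlim p).norm) fun n => hbound n p
  have hDCT : Tendsto (fun n => ∫ p, Fn n p ∂μ) atTop (𝓝 (∫ p, F p ∂μ)) :=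
    tendsto_integral_of_dominated_convergence G hFn_meas hGint
      (fun n => Eventually.of_forall (hbound n)) (Eventually.of_forall hlim)
  -- ### the datum term
  have hdatum : Tendsto (fun n => ∫ x, ⟪v₀ x, ψn n 0 x⟫) atTop
      (𝓝 (∫ x, ⟪v₀ x, 𝐋[a, c] (fderiv ℝ (Ψ 0) x)⟫)) := by
    set S₀ : E → ℝ := fun x => ∑ k ∈ Finset.range 2, ‖iteratedFDeriv ℝ k (Ψ 0) x‖ with hS₀_def
    have hS₀m : MemLp S₀ 2 volume :=
      memLp_finsetSum _ fun k hk => (MemLp.norm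
        ⟨((contDiff_slice_of_contDiff_uncurry hΨ 0).continuous_iteratedFDeriv
          (by exact_mod_cast le_top)).aestronglyMeasurable,
        h0 k (Nat.lt_succ_iff.1 (Finset.mem_range.1 hk))⟩)
    have hbint : Integrable (fun x => A * K 1 * (‖v₀ x‖ * S₀ x)) volume :=
      (hv₀.norm.integrable_mul hS₀m).const_mul _
    refine tendsto_integral_of_dominated_convergence (fun x => A * K 1 * (‖v₀ x‖ * S₀ x))
      (fun n => hv₀.1.inner ((contDiff_slice_of_contDiff_uncurry (hψns n) 0).continuous.aestronglyMeasurable))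
      hbint (fun n => Eventually.of_forall fun x => ?_) (Eventually.of_forall fun x => ?_)
    · refine (norm_inner_le_norm _ _).trans ?_
      have hx : ‖ψn n 0 x‖ ≤ A * K 1 * S₀ x := by
        calc ‖ψn n 0 x‖ ≤ 2 * ‖a‖ * ‖c‖ * ‖iteratedFDeriv ℝ 1 (Φ n 0) x‖ := norm_curlPair_le x
          _ ≤ 2 * ‖a‖ * ‖c‖ * (K 1 * S 1 (0, x)) := by gcongr; exact hLeib n 1 (by norm_num) 0 x
          _ = A * K 1 * S₀ x := by rw [hA_def]; ring
      calc ‖v₀ x‖ * ‖ψn n 0 x‖ ≤ ‖v₀ x‖ * (A * K 1 * S₀ x) := by gcongr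
        _ = A * K 1 * (‖v₀ x‖ * S₀ x) := by ring
    · refine tendsto_const_nhds.congr' ?_
      filter_upwards [eventually_forall_cutoff_mul_eq Ψ x] with n hn
      have hev : Φ n 0 =ᶠ[𝓝 x] Ψ 0 := by
        filter_upwards [isOpen_ball.mem_nhds (mem_ball_self one_pos)] with z hz
        exact hn 0 z hz
      show ⟪v₀ x, 𝐋[a, c] (fderiv ℝ (Ψ 0) x)⟫ = ⟪v₀ x, 𝐋[a, c] (fderiv ℝ (Φ n 0) x)⟫
      rw [hev.fderiv_eq]
  -- ### conclusion
  have hprod : ∀ n, (∫ t in Ioo 0 T, ∫ x, (⟪v t x, timeDeriv (ψn n) t x⟫ +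
      ⟪v t x, convect (v t) (ψn n t) x⟫ + ν * ⟪v t x, Δ (ψn n t) x⟫)) = ∫ p, Fn n p ∂μ := by
    intro n
    rw [hμ, integral_prod _ (hFint n)]
    rfl
  have hprod' : (∫ t in Ioo 0 T, ∫ x, (⟪v t x, timeDeriv (fun t x => 𝐋[a, c] (fderiv ℝ (Ψ t) x)) t x⟫ +
      ⟪v t x, convect (v t) (fun x => 𝐋[a, c] (fderiv ℝ (Ψ t) x)) x⟫ +
      ν * ⟪v t x, Δ (fun x => 𝐋[a, c] (fderiv ℝ (Ψ t) x)) x⟫)) = ∫ p, F p ∂μ := by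
    rw [hμ, integral_prod _ hFint']
    rfl
  have hsum : Tendsto (fun n => (∫ p, Fn n p ∂μ) + ∫ x, ⟪v₀ x, ψn n 0 x⟫) atTop
      (𝓝 ((∫ p, F p ∂μ) + ∫ x, ⟪v₀ x, 𝐋[a, c] (fderiv ℝ (Ψ 0) x)⟫)) := hDCT.add hdatum
  have hzero : (fun n => (∫ p, Fn n p ∂μ) + ∫ x, ⟪v₀ x, ψn n 0 x⟫) = fun _ => 0 := by
    funext n
    rw [← hprod n]
    exact hweak n
  rw [hzero] at hsum
  rw [hprod']
  exact (tendsto_nhds_unique hsum tendsto_const_nhds)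

/-! #### Integrability of the three bulk terms and the identity in product form -/

variable {μ : Measure (ℝ × E)} {V : ℝ × E → E} {Ψ : ℝ → E → ℝ} {ψ : ℝ → E → E} {a c : E}

/-- `⟪V, ∂ₜψ⟫` is integrable for `V ∈ L⁴` and `D(∂ₜΨ) ∈ L^{4/3}` (`ψ` the curl-type field of
`Ψ`). [folklore] -/
theorem integrable_inner_timeDeriv_curlPair (hV4 : MemLp V 4 μ) (hΨ : ContDiff ℝ ∞ (uncurry Ψ))
    (ht : eLpNorm (fun p : ℝ × E => iteratedFDeriv ℝ 1 (timeDeriv Ψ p.1) p.2) (4 / 3) μ < ⊤)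
    (hψ : ∀ t x, ψ t x = (fderiv ℝ (Ψ t) x a) • c - (fderiv ℝ (Ψ t) x c) • a) :
    Integrable (fun p : ℝ × E => ⟪V p, timeDeriv ψ p.1 p.2⟫) μ := by
  obtain rfl : ψ = fun t x => 𝐋[a, c] (fderiv ℝ (Ψ t) x) := by
    funext t x; rw [hψ, curlPairCLM_apply]
  have hm : MemLp (fun p : ℝ × E => 2 * ‖a‖ * ‖c‖ * ‖iteratedFDeriv ℝ 1 (timeDeriv Ψ p.1) p.2‖)
      (4 / 3) μ :=
    (MemLp.norm ⟨(continuous_iteratedFDeriv_slice (contDiff_uncurry_timeDeriv hΨ) 1).aestronglyMeasurable,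
      ht⟩).const_mul _
  refine (integrable_norm_mul_of_four_fourThirds hV4 hm).mono'
    (hV4.1.inner (contDiff_uncurry_timeDeriv (contDiff_uncurry_curlPair hΨ)).continuous.aestronglyMeasurable)
    (Eventually.of_forall fun p => ?_)
  refine (norm_inner_le_norm _ _).trans ?_
  gcongr
  rw [show timeDeriv (fun t x => 𝐋[a, c] (fderiv ℝ (Ψ t) x)) p.1 p.2 =
    𝐋[a, c] (fderiv ℝ (timeDeriv Ψ p.1) p.2) from timeDeriv_curlPair hΨ p.1 p.2]
  exact norm_curlPair_le p.2

/-- `⟪V, (Dψ) V⟫` is integrable for `V ∈ L⁴` and `D²Ψ ∈ L²`. [folklore] -/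
theorem integrable_inner_fderiv_curlPair_apply (hV4 : MemLp V 4 μ) (hΨ : ContDiff ℝ ∞ (uncurry Ψ))
    (h2 : eLpNorm (fun p : ℝ × E => iteratedFDeriv ℝ 2 (Ψ p.1) p.2) 2 μ < ⊤)
    (hψ : ∀ t x, ψ t x = (fderiv ℝ (Ψ t) x a) • c - (fderiv ℝ (Ψ t) x c) • a) :
    Integrable (fun p : ℝ × E => ⟪V p, fderiv ℝ (ψ p.1) p.2 (V p)⟫) μ := by
  obtain rfl : ψ = fun t x => 𝐋[a, c] (fderiv ℝ (Ψ t) x) := by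
    funext t x; rw [hψ, curlPairCLM_apply]
  have hm : MemLp (fun p : ℝ × E => 2 * ‖a‖ * ‖c‖ * ‖iteratedFDeriv ℝ 2 (Ψ p.1) p.2‖) 2 μ :=
    (MemLp.norm ⟨(continuous_iteratedFDeriv_slice hΨ 2).aestronglyMeasurable, h2⟩).const_mul _
  have hmeas : AEStronglyMeasurable
      (fun p : ℝ × E => fderiv ℝ (fun x => 𝐋[a, c] (fderiv ℝ (Ψ p.1) x)) p.2 (V p)) μ :=
    (isBoundedBilinearMap_apply (𝕜 := ℝ) (E := E) (F := E)).continuous.comp_aestronglyMeasurable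
      ((contDiff_uncurry_fderiv_slice (contDiff_uncurry_curlPair hΨ)).continuous.aestronglyMeasurable.prodMk
        hV4.1)
  refine (integrable_norm_sq_mul_of_four_two hV4 hm).mono' (hV4.1.inner hmeas)
    (Eventually.of_forall fun p => ?_)
  refine (norm_inner_le_norm _ _).trans ?_
  calc ‖V p‖ * ‖fderiv ℝ (fun x => 𝐋[a, c] (fderiv ℝ (Ψ p.1) x)) p.2 (V p)‖
      ≤ ‖V p‖ * (‖fderiv ℝ (fun x => 𝐋[a, c] (fderiv ℝ (Ψ p.1) x)) p.2‖ * ‖V p‖) := by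
        gcongr; exact ContinuousLinearMap.le_opNorm _ _
    _ ≤ ‖V p‖ * ((2 * ‖a‖ * ‖c‖ * ‖iteratedFDeriv ℝ 2 (Ψ p.1) p.2‖) * ‖V p‖) := by
        gcongr; exact norm_fderiv_curlPair_le (contDiff_slice_of_contDiff_uncurry hΨ p.1) p.2
    _ = ‖V p‖ ^ 2 * (2 * ‖a‖ * ‖c‖ * ‖iteratedFDeriv ℝ 2 (Ψ p.1) p.2‖) := by ring

/-- `⟪V, Δψ⟫` is integrable for `V ∈ L⁴` and `D³Ψ ∈ L^{4/3}`. [folklore] -/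
theorem integrable_inner_laplacian_curlPair (hV4 : MemLp V 4 μ) (hΨ : ContDiff ℝ ∞ (uncurry Ψ))
    (h3 : eLpNorm (fun p : ℝ × E => iteratedFDeriv ℝ 3 (Ψ p.1) p.2) (4 / 3) μ < ⊤)
    (hψ : ∀ t x, ψ t x = (fderiv ℝ (Ψ t) x a) • c - (fderiv ℝ (Ψ t) x c) • a) :
    Integrable (fun p : ℝ × E => ⟪V p, Δ (ψ p.1) p.2⟫) μ := by
  obtain rfl : ψ = fun t x => 𝐋[a, c] (fderiv ℝ (Ψ t) x) := by
    funext t x; rw [hψ, curlPairCLM_apply]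
  have hm : MemLp (fun p : ℝ × E =>
      2 * ‖a‖ * ‖c‖ * (Module.finrank ℝ E) * ‖iteratedFDeriv ℝ 3 (Ψ p.1) p.2‖) (4 / 3) μ :=
    (MemLp.norm ⟨(continuous_iteratedFDeriv_slice hΨ 3).aestronglyMeasurable, h3⟩).const_mul _
  have hcont : Continuous fun p : ℝ × E => Δ (fun x => 𝐋[a, c] (fderiv ℝ (Ψ p.1) x)) p.2 := by
    have h := (isSmoothSpaceTimeOn_univ_of_contDiff (contDiff_uncurry_curlPair (a := a) (c := c) hΨ)).laplacian
      uniqueDiffOn_univ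
    exact (contDiff_of_isSmoothSpaceTimeOn_univ h).continuous
  refine (integrable_norm_mul_of_four_fourThirds hV4 hm).mono' (hV4.1.inner hcont.aestronglyMeasurable)
    (Eventually.of_forall fun p => ?_)
  refine (norm_inner_le_norm _ _).trans ?_
  gcongr
  exact norm_laplacian_curlPair_le (contDiff_slice_of_contDiff_uncurry hΨ p.1) p.2

/-- **The extended weak formulation in product form**, with the three bulk terms separated:
`∫_{(0,T)×E} ⟪v, ∂ₜψ⟫ + ∫_{(0,T)×E} ⟪v, (v·∇)ψ⟫ + ν ∫_{(0,T)×E} ⟪v, Δψ⟫ + ∫ ⟪v₀, ψ(0)⟫ = 0`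
(same hypotheses as `IsWeakNSSolutionOn.weakForm_curlPair_extended`; Fubini). [cite: Galdi2018, proof of Thm. 1.1, (2.12) and Lemma A.1] -/
theorem IsWeakNSSolutionOn.weakForm_curlPair_extended_prod
    {T ν : ℝ} {v₀ : E → E} {v : ℝ → E → E} (hw : IsWeakNSSolutionOn T ν 0 v₀ v)
    (hv₀ : MemLp v₀ 2 volume)
    (hv4 : eLpNorm (uncurry v) 4 ((volume.restrict (Ioo 0 T)).prod (volume : Measure E)) < ⊤)
    (hΨ : ContDiff ℝ ∞ (uncurry Ψ)) {t₀ b : ℝ} (hbT : b < T)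
    (hsupp : ∀ t, t ∉ Icc t₀ b → Ψ t = 0)
    (h43 : ∀ k ≤ 3, eLpNorm (fun p : ℝ × E => iteratedFDeriv ℝ k (Ψ p.1) p.2) (4 / 3)
      ((volume.restrict (Ioo 0 T)).prod (volume : Measure E)) < ⊤)
    (h2 : ∀ k ≤ 2, eLpNorm (fun p : ℝ × E => iteratedFDeriv ℝ k (Ψ p.1) p.2) 2
      ((volume.restrict (Ioo 0 T)).prod (volume : Measure E)) < ⊤)
    (ht43 : ∀ k ≤ 1, eLpNorm (fun p : ℝ × E => iteratedFDeriv ℝ k (timeDeriv Ψ p.1) p.2) (4 / 3)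
      ((volume.restrict (Ioo 0 T)).prod (volume : Measure E)) < ⊤)
    (h0 : ∀ k ≤ 1, eLpNorm (fun x => iteratedFDeriv ℝ k (Ψ 0) x) 2 (volume : Measure E) < ⊤)
    (a c : E)
    (hψ : ∀ t x, ψ t x = (fderiv ℝ (Ψ t) x a) • c - (fderiv ℝ (Ψ t) x c) • a) :
    (∫ p, ⟪v p.1 p.2, timeDeriv ψ p.1 p.2⟫ ∂((volume.restrict (Ioo 0 T)).prod (volume : Measure E))) +
      (∫ p, ⟪v p.1 p.2, fderiv ℝ (ψ p.1) p.2 (v p.1 p.2)⟫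
        ∂((volume.restrict (Ioo 0 T)).prod (volume : Measure E))) +
      ν * (∫ p, ⟪v p.1 p.2, Δ (ψ p.1) p.2⟫ ∂((volume.restrict (Ioo 0 T)).prod (volume : Measure E))) +
      ∫ x, ⟪v₀ x, ψ 0 x⟫ = 0 := by
  have hmain := hw.weakForm_curlPair_extended hv₀ hv4 hΨ hbT hsupp h43 h2 ht43 h0 a c hψ
  set μ : Measure (ℝ × E) := (volume.restrict (Ioo 0 T)).prod (volume : Measure E) with hμ
  have hV4 : MemLp (uncurry v) 4 μ := ⟨aestronglyMeasurable_uncurry_prod_of_restrict hw.1, hv4⟩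
  have i1 := integrable_inner_timeDeriv_curlPair hV4 hΨ (ht43 1 le_rfl) hψ
  have i2 := integrable_inner_fderiv_curlPair_apply hV4 hΨ (h2 2 le_rfl) hψ
  have i3 := integrable_inner_laplacian_curlPair hV4 hΨ (h43 3 le_rfl) hψ
  have hsum : Integrable (fun p : ℝ × E => ⟪uncurry v p, timeDeriv ψ p.1 p.2⟫ +
      ⟪uncurry v p, fderiv ℝ (ψ p.1) p.2 (uncurry v p)⟫ + ν * ⟪uncurry v p, Δ (ψ p.1) p.2⟫) μ :=
    (i1.add i2).add (i3.const_mul ν)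
  have hiter : (∫ t in Ioo 0 T, ∫ x, (⟪v t x, timeDeriv ψ t x⟫ + ⟪v t x, convect (v t) (ψ t) x⟫ +
      ν * ⟪v t x, Δ (ψ t) x⟫)) = ∫ p, (⟪uncurry v p, timeDeriv ψ p.1 p.2⟫ +
      ⟪uncurry v p, fderiv ℝ (ψ p.1) p.2 (uncurry v p)⟫ + ν * ⟪uncurry v p, Δ (ψ p.1) p.2⟫) ∂μ := by
    rw [hμ, integral_prod _ hsum]
    rfl
  have i12 : Integrable (fun p : ℝ × E => ⟪uncurry v p, timeDeriv ψ p.1 p.2⟫ +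
      ⟪uncurry v p, fderiv ℝ (ψ p.1) p.2 (uncurry v p)⟫) μ := i1.add i2
  have i3' : Integrable (fun p : ℝ × E => ν * ⟪uncurry v p, Δ (ψ p.1) p.2⟫) μ := i3.const_mul ν
  have e1 := integral_add i12 i3'
  rw [integral_add i1 i2, integral_const_mul] at e1
  rw [hiter, e1] at hmain
  exact hmain

end Extension





end Literature.Analysis.FluidPDE
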